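import Summits.QuantumFields.YangMills.Theorems.InfiniteVolumeReflectionPositivityOn
import Summits.QuantumFields.YangMills.Theorems.InfiniteVolumeHyperoctahedralOn
import HarnessLib

/-!
# Route `InfiniteVolumeContinuum` (target stmt-QuantumFields-19927): the E2 support and the hyperoctahedral clause
# ON A TORUS CLASS — Theses-free, binder-agnostic closers for the class-local DATA clause

Seat `ym-infvol-p3` (R136 (i); the E2 support `IVReflectionPositivity`, stmt-QuantumFields-19932, is CLOSED by
`InfiniteVolumeContinuum.IVReflectionPositivity_holds`, p461225).  HONEST FRAMING: existence half only, conditional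
on Track A's `BalabanLadder.UV` through the route; this file is unconditional soft analysis (no `MomentBounds6`, no
`ROT`, no `GapInUnits` binder is used); nothing about Yang–Mills is asserted; not a gap, not Clay.

WHY THIS FILE (route owner ym-beyond-p2 g21∕g22, `R85-BATCH-EDITS.md` rev 3e §5b; seat p1's located memo
`R85-ROT-IMPACT-infvol.md` d05b09b994a7a85f, §3 options (ii)∕(iii′)∕(iv)).  The planned restate of the spine's rotation
crux `ROT` to rev 2′ delivers the Ward identities only along schemes whose torus HALF-SIDES lie in an unbounded class
`𝒮`; under option (ii) the route's DATA clause becomes CLASS-LOCAL — states `μ k` that are infinite-volume limits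
ALONG odd tori `2·N k j + 1` with `N k j ∈ 𝒮` — and the three supports are re-closed by re-packaging; under (iii′)∕(iv)
the leaf keeps the gap-free HYPEROCTAHEDRAL clause `∀ R, IsSignedPerm R → Invariant S₁ R`.  This file supplies the
prover side of both for E2, with binders ordered EXACTLY as in seat p1's class-local E1 support
`E1.isEuclideanInvariant_of_latticeRotWardOn` (`r a 𝒮 β μ N S₁ T`, then `hapos ha0 hβ hN hN𝒮 hμ h0 h1 hS hT`), so that
whichever along-`𝒮` DATA text the planner files closes by `exact` after `choose`-ing the sequences
(namespace `Summit.QuantumFields.YangMills.Theorems.InfiniteVolume.E2`):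

* `rpPos_of_dataAlong` ∕ `isReflectionPositive_of_dataAlong` — E2 (`RPPos S₁`, `S₁.toLabelled.IsReflectionPositive`)
  of the centre-smeared continuum data of states chosen along odd tori of half-sides in ANY class `𝒮` (the class and
  the membership binder are carried only for binder alignment: lattice E2 is exact for every torus limit state, seat
  p3's `InfVolRP.rpPos_of_oddTorusLimitStates_centre` ∕ seat p2's parity-free `InfVolRP.rpPos_of_limitStates_centre`);
  this is also the `hRP : RPPos S₁` input of p1's `isEuclideanInvariant_of_latticeRotWardOn`.
* `rpPos_of_dataLimitStates` — the same with states given only as torus limit points of ANY side parity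
  (`μ k ∈ infiniteVolumeLimitPoints r.ρ (β k)`; Track A's even family tori included), DATA-shaped binders.
* `signedPerm_invariant_of_dataAlong` — the hyperoctahedral clause of options (iii′)∕(iv) along `𝒮` (seat p3's W1
  `E1.stub_ivSigned` mechanism through seat p2's parity-free `InfiniteVolume.signedPerm_invariant_of_limitStates`;
  needs neither `β → ∞` nor `a > 0`).

References: K. Osterwalder, R. Schrader, CMP 31 (1973) §2, CMP 42 (1975) §4; K. Osterwalder, E. Seiler, Ann. Phys. 110
(1978) §2; J. Glimm, A. Jaffe, Quantum Physics (1987) §6.1.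
-/

set_option autoImplicit false

noncomputable section

open scoped SchwartzMap BigOperators
open MeasureTheory Filter Topology
open Literature.MathematicalPhysics.QuantumFieldTheory hiding ZdEdge
open Literature.MathematicalPhysics.QuantumLattice
open Literature.MathematicalPhysics.AQFT
open Literature.Probability.LatticeModels (Site)
open Summit.QuantumFields.YangMills.Cruxes.OSLegsFromFemtoAndGap.DlrCollarTransfer (RPPos isReflectionPositive_of_rpPos)
open Summit.QuantumFields.YangMills.Cruxes.OSLegsAtWeakCouplingC.Sketch (Invariant IsSignedPerm)
open Summit.QuantumFields.YangMills.Theorems.InfVolRP (rpPos_of_limitStates_centre)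

namespace Summit.QuantumFields.YangMills.Theorems.InfiniteVolume.E2

variable {G : Type} [Group G] [TopologicalSpace G] [IsTopologicalGroup G] [CompactSpace G]
  [MeasurableSpace G] [BorelSpace G]

/-- **E2 of the infinite-volume-first continuum data of torus limit states of ANY side parity, DATA-shaped binders**:
a positive unit `a → 0` (as `β → ∞`), couplings `β k → ∞`, states `μ k ∈ infiniteVolumeLimitPoints r.ρ (β k)` (limits
along arbitrary strictly increasing side sequences, odd or even), the conventions `S₁ 0 = ev`, `S₁ 1 = 0`,
`S₁ n = Σ_q T n q` and the centre-smeared DATA convergence: then `RPPos S₁` and `S₁.toLabelled.IsReflectionPositive`.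
(`G` is Hausdorff and second countable by the faithful representation `r`; `β k ≥ 0` eventually; lattice E2 exact for
every torus limit state, parity-free: seat p2's `InfVolRP.rpPos_of_limitStates_centre`.) [folklore] -/
theorem rpPos_of_dataLimitStates (r : LatticeRep G) (a : ℝ → ℝ) (β : ℕ → ℝ) (μ : ℕ → Measure (LGConfig 4 G))
    (S₁ : SchwingerFamily (EuclideanSpace ℝ (Fin 4)))
    (T : (n : ℕ) → (Fin n → Fin 4 × Fin 4) → (𝓢((Fin n → EuclideanSpace ℝ (Fin 4)), ℂ) →L[ℂ] ℂ))
    (hapos : ∀ b, 0 < a b) (ha0 : Tendsto a atTop (𝓝 0)) (hβ : Tendsto β atTop atTop)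
    (hμ : ∀ k, μ k ∈ infiniteVolumeLimitPoints (d := 4) r.ρ (β k))
    (h0 : ∀ F : 𝓢((Fin 0 → EuclideanSpace ℝ (Fin 4)), ℂ), S₁ 0 F = F default)
    (h1 : ∀ F : 𝓢((Fin 1 → EuclideanSpace ℝ (Fin 4)), ℂ), S₁ 1 F = 0)
    (hS : ∀ n : ℕ, 2 ≤ n → ∀ F : 𝓢((Fin n → EuclideanSpace ℝ (Fin 4)), ℂ),
      S₁ n F = ∑ q ∈ Fintype.piFinset (fun _ : Fin n => Finset.univ.filter fun p : Fin 4 × Fin 4 => p.1 < p.2), T n q F)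
    (hT : ∀ n : ℕ, 2 ≤ n → ∀ q : Fin n → Fin 4 × Fin 4, (∀ i, (q i).1 < (q i).2) →
      ∀ F : 𝓢((Fin n → EuclideanSpace ℝ (Fin 4)), ℂ), IsOffDiagonal F →
        Tendsto (fun k => ∑' x : Fin n → (Fin 4 → ℤ), ((stateMomentStr G r (μ k) n q x : ℝ) : ℂ) *
          F (fun l => a (β k) • siteToE (x l) + (a (β k) / 2) •
            (EuclideanSpace.single (q l).1 (1 : ℝ) + EuclideanSpace.single (q l).2 (1 : ℝ)))) atTop (𝓝 (T n q F))) :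
    RPPos S₁ ∧ S₁.toLabelled.IsReflectionPositive := by
  -- a faithful continuous matrix representation of the compact group makes it Hausdorff and second countable
  haveI : T2Space G := (r.continuous.isClosedEmbedding r.injective).isEmbedding.t2Space
  haveI : SecondCountableTopology G :=
    (r.continuous.isClosedEmbedding r.injective).isEmbedding.secondCountableTopology
  exact rpPos_of_limitStates_centre r (hβ.eventually_ge_atTop 0) μ hμ (fun k => hapos (β k)) (ha0.comp hβ) T hT
    S₁ hS h0 h1

/-- **E2 support ON A CLASS (`RPPos`)** — binders aligned with `E1.isEuclideanInvariant_of_latticeRotWardOn`: for every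
compact `G`, `r`, positive unit `a → 0`, ANY class `𝒮` of half-sides, every tuple `(β, μ, N, S₁, T)` with `β k → ∞`,
states `μ k` that are infinite-volume limits ALONG odd tori `2·N k j + 1` (`N k` strictly increasing, `N k j ∈ 𝒮`), the
conventions and the centre-smeared DATA convergence: `RPPos S₁`.  The class plays no role (lattice E2 is exact for
every torus limit state); the binders `𝒮`, `hN𝒮` are carried so that a class-local DATA clause closes by `exact`.
[folklore] -/
theorem rpPos_of_dataAlong (r : LatticeRep G) (a : ℝ → ℝ) (𝒮 : Set ℕ) (β : ℕ → ℝ)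
    (μ : ℕ → Measure (LGConfig 4 G)) (N : ℕ → ℕ → ℕ)
    (S₁ : SchwingerFamily (EuclideanSpace ℝ (Fin 4)))
    (T : (n : ℕ) → (Fin n → Fin 4 × Fin 4) → (𝓢((Fin n → EuclideanSpace ℝ (Fin 4)), ℂ) →L[ℂ] ℂ))
    (hapos : ∀ b, 0 < a b) (ha0 : Tendsto a atTop (𝓝 0)) (hβ : Tendsto β atTop atTop)
    (hN : ∀ k, StrictMono (N k)) (_hN𝒮 : ∀ k j, N k j ∈ 𝒮)
    (hμ : ∀ k, IsInfiniteVolumeLimitAlong (d := 4) r.ρ (β k) (fun j => 2 * N k j) (μ k))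
    (h0 : ∀ F : 𝓢((Fin 0 → EuclideanSpace ℝ (Fin 4)), ℂ), S₁ 0 F = F default)
    (h1 : ∀ F : 𝓢((Fin 1 → EuclideanSpace ℝ (Fin 4)), ℂ), S₁ 1 F = 0)
    (hS : ∀ n : ℕ, 2 ≤ n → ∀ F : 𝓢((Fin n → EuclideanSpace ℝ (Fin 4)), ℂ),
      S₁ n F = ∑ q ∈ Fintype.piFinset (fun _ : Fin n => Finset.univ.filter fun p : Fin 4 × Fin 4 => p.1 < p.2), T n q F)
    (hT : ∀ n : ℕ, 2 ≤ n → ∀ q : Fin n → Fin 4 × Fin 4, (∀ i, (q i).1 < (q i).2) →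
      ∀ F : 𝓢((Fin n → EuclideanSpace ℝ (Fin 4)), ℂ), IsOffDiagonal F →
        Tendsto (fun k => ∑' x : Fin n → (Fin 4 → ℤ), ((stateMomentStr G r (μ k) n q x : ℝ) : ℂ) *
          F (fun l => a (β k) • siteToE (x l) + (a (β k) / 2) •
            (EuclideanSpace.single (q l).1 (1 : ℝ) + EuclideanSpace.single (q l).2 (1 : ℝ)))) atTop (𝓝 (T n q F))) :
    RPPos S₁ :=
  (rpPos_of_dataLimitStates r a β μ S₁ T hapos ha0 hβ
    (fun k => ⟨fun j => 2 * N k j, fun i j hij => by have := hN k hij; dsimp only; omega, hμ k⟩)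
    h0 h1 hS hT).1

/-- **E2 support ON A CLASS (`IsReflectionPositive`)** — the OS-E2 form of `rpPos_of_dataAlong`. [folklore] -/
theorem isReflectionPositive_of_dataAlong (r : LatticeRep G) (a : ℝ → ℝ) (𝒮 : Set ℕ) (β : ℕ → ℝ)
    (μ : ℕ → Measure (LGConfig 4 G)) (N : ℕ → ℕ → ℕ)
    (S₁ : SchwingerFamily (EuclideanSpace ℝ (Fin 4)))
    (T : (n : ℕ) → (Fin n → Fin 4 × Fin 4) → (𝓢((Fin n → EuclideanSpace ℝ (Fin 4)), ℂ) →L[ℂ] ℂ))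
    (hapos : ∀ b, 0 < a b) (ha0 : Tendsto a atTop (𝓝 0)) (hβ : Tendsto β atTop atTop)
    (hN : ∀ k, StrictMono (N k)) (_hN𝒮 : ∀ k j, N k j ∈ 𝒮)
    (hμ : ∀ k, IsInfiniteVolumeLimitAlong (d := 4) r.ρ (β k) (fun j => 2 * N k j) (μ k))
    (h0 : ∀ F : 𝓢((Fin 0 → EuclideanSpace ℝ (Fin 4)), ℂ), S₁ 0 F = F default)
    (h1 : ∀ F : 𝓢((Fin 1 → EuclideanSpace ℝ (Fin 4)), ℂ), S₁ 1 F = 0)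
    (hS : ∀ n : ℕ, 2 ≤ n → ∀ F : 𝓢((Fin n → EuclideanSpace ℝ (Fin 4)), ℂ),
      S₁ n F = ∑ q ∈ Fintype.piFinset (fun _ : Fin n => Finset.univ.filter fun p : Fin 4 × Fin 4 => p.1 < p.2), T n q F)
    (hT : ∀ n : ℕ, 2 ≤ n → ∀ q : Fin n → Fin 4 × Fin 4, (∀ i, (q i).1 < (q i).2) →
      ∀ F : 𝓢((Fin n → EuclideanSpace ℝ (Fin 4)), ℂ), IsOffDiagonal F →
        Tendsto (fun k => ∑' x : Fin n → (Fin 4 → ℤ), ((stateMomentStr G r (μ k) n q x : ℝ) : ℂ) *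
          F (fun l => a (β k) • siteToE (x l) + (a (β k) / 2) •
            (EuclideanSpace.single (q l).1 (1 : ℝ) + EuclideanSpace.single (q l).2 (1 : ℝ)))) atTop (𝓝 (T n q F))) :
    S₁.toLabelled.IsReflectionPositive :=
  (rpPos_of_dataLimitStates r a β μ S₁ T hapos ha0 hβ
    (fun k => ⟨fun j => 2 * N k j, fun i j hij => by have := hN k hij; dsimp only; omega, hμ k⟩)
    h0 h1 hS hT).2

/-- **The hyperoctahedral clause ON A CLASS** (options (iii′)∕(iv): the maximal gap-free, `ROT`-free symmetry the
lattice gives): for states `μ k` that are infinite-volume limits along odd tori of half-sides in any class `𝒮`, any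
scales, the conventions and the centre-smeared DATA convergence (written with `a (β k)`), every signed permutation of
the coordinate axes fixes `S₁` on `⁰𝒮` (seat p2's parity-free `signedPerm_invariant_of_limitStates`, i.e. seat p3's
W1 mechanism; no positivity of `a`, no `β → ∞`). [folklore] -/
theorem signedPerm_invariant_of_dataAlong (r : LatticeRep G) (a : ℝ → ℝ) (𝒮 : Set ℕ) (β : ℕ → ℝ)
    (μ : ℕ → Measure (LGConfig 4 G)) (N : ℕ → ℕ → ℕ)
    (S₁ : SchwingerFamily (EuclideanSpace ℝ (Fin 4)))
    (T : (n : ℕ) → (Fin n → Fin 4 × Fin 4) → (𝓢((Fin n → EuclideanSpace ℝ (Fin 4)), ℂ) →L[ℂ] ℂ))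
    (hN : ∀ k, StrictMono (N k)) (_hN𝒮 : ∀ k j, N k j ∈ 𝒮)
    (hμ : ∀ k, IsInfiniteVolumeLimitAlong (d := 4) r.ρ (β k) (fun j => 2 * N k j) (μ k))
    (h0 : ∀ F : 𝓢((Fin 0 → EuclideanSpace ℝ (Fin 4)), ℂ), S₁ 0 F = F default)
    (h1 : ∀ F : 𝓢((Fin 1 → EuclideanSpace ℝ (Fin 4)), ℂ), S₁ 1 F = 0)
    (hS : ∀ n : ℕ, 2 ≤ n → ∀ F : 𝓢((Fin n → EuclideanSpace ℝ (Fin 4)), ℂ),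
      S₁ n F = ∑ q ∈ Fintype.piFinset (fun _ : Fin n => Finset.univ.filter fun p : Fin 4 × Fin 4 => p.1 < p.2), T n q F)
    (hT : ∀ n : ℕ, 2 ≤ n → ∀ q : Fin n → Fin 4 × Fin 4, (∀ i, (q i).1 < (q i).2) →
      ∀ F : 𝓢((Fin n → EuclideanSpace ℝ (Fin 4)), ℂ), IsOffDiagonal F →
        Tendsto (fun k => ∑' x : Fin n → (Fin 4 → ℤ), ((stateMomentStr G r (μ k) n q x : ℝ) : ℂ) *
          F (fun l => a (β k) • siteToE (x l) + (a (β k) / 2) •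
            (EuclideanSpace.single (q l).1 (1 : ℝ) + EuclideanSpace.single (q l).2 (1 : ℝ)))) atTop (𝓝 (T n q F))) :
    ∀ R : EuclideanSpace ℝ (Fin 4) ≃ₗᵢ[ℝ] EuclideanSpace ℝ (Fin 4), IsSignedPerm R → Invariant S₁ R :=
  signedPerm_invariant_of_limitStates r (fun k => a (β k)) β μ S₁ T
    (fun k => ⟨fun j => 2 * N k j, fun i j hij => by have := hN k hij; dsimp only; omega, hμ k⟩) h0 h1 hS hT

end Summit.QuantumFields.YangMills.Theorems.InfiniteVolume.E2

end
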